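import Literature.NumberTheory.Automorphic.UnitaryGroupHyperbolicTruncatedTracePolynomialCMTwo
import HarnessLib

/-!
# (`U(J₂)`, `H`-side copy) The regular hyperbolic socket of the coarse `𝔬`-expansion, closed:
# `Σ_{i ∈ S_f, i hyperbolic} p_i(0) = −c_μ·C_w·Σ_i J^v(γ_i, f)` on the quasi-split `U(J₂)` of a CM field
(Rogawski, *Automorphic Representations of Unitary Groups in Three Variables* (1990), §2.3 p. 14 («`J(f) = Σ_𝔬 J_𝔬(f)`,
`J_𝔬(f)` the constant term of `J^T_𝔬(f)`»), §6.1 pp. 79–80; §7.3 pp. 97–98, (6.1.1)–(6.1.3) (the weighted orbital integrals of the regular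
elements of `M`); Arthur, *A trace formula for reductive groups I*, Duke Math. J. 45 (1978), §8; Arthur, *The trace formula
in invariant form*, Ann. of Math. 114 (1981), Prop. 2.3.)

Topic `NumberTheory/Automorphic`; namespace `Literature.NumberTheory.Automorphic.UnitaryGroup`. THEOREMS ONLY over accepted
tree modules: no definition, no named fact, no instance, no notation, no `sorry`. Row (L5-ii) «(σ-iii) FINSET CLOSER» of the
T1-qs LAW 5 road of `Cruxes/H413/Lines/F0_T1InnerFormTraceIdentity.lean` (cell `pub/hodgecm-mathlib`, crux H413; LAW sub-lead
word 12:31:54Z).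

THE SOCKET. (at `N = 3`: ★ `arthurTrace_eq_sum_orbital_add_sum_central_add_sum_singular_add_sum_hyperbolic_cm`; at `N = 2` the two-socket
expansion over ★ `sum_filter_meetsBorel_eq_sum_central_add_sum_hyperbolic_two`) writes Arthur's `J(f)` for the Borel-refined class map `cl♭ = (charpoly ∘ adelicVal, flag)` as the elliptic orbital sum plus three
sums `Σ p_i(0)` over the central, the singular and the REGULAR HYPERBOLIC refined classes `i` of the live set `S♭_f` — the last
filter being `i.2 = true ∧ ∃ a ∈ Lˣ, c a · a ≠ 1 ∧ i.1 = ((X − a)(X − (c a)⁻¹)) ⊗ 𝔸_L` (★ `sum_filter_meetsBorel_eq_sum_central_add_sum_hyperbolic_two`'s hyperbolic filter) — with ONE family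
`P` of class polynomials, `J^T_i(f) = (P i)(log T)` for `T ≫ 0` at every `i ∈ S♭_f`.
THE ROW. ★ (W-asm) STEP 5 `truncatedTraceClass_borelRefine_hyperbolic_eq_linear_cm_of_window`
(`UnitaryGroupHyperbolicTruncatedTracePolynomialCM`, Rogawski's (6.1.3)): at the class `i♯` of a diagonal `γ♯ = d(a, (c a)⁻¹)`,
for EVERY window constant `C_w ≠ ∞` of the torus measure `ρ`, every polynomial computing `J^T_{i♯}(f)` above a threshold is
`C (2·c_μ·C_w·Φ(γ♯, f))·X + C (−c_μ·C_w·J^v(γ♯, f))`.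
THIS FILE puts the two together over the whole hyperbolic filter, with ONE `C_w` for all classes (all the `γ_i` live in the one
diagonal torus `T(𝔸)`, `w = J₂` fixed):

* §1 (generic quadratic `E/F`, `c² = 1`) **`exists_hyperbolicDiagonal_of_mem_filter_hyperbolic`** — every index of the hyperbolic
  filter has a diagonal rational representative: `∃ a g₀, c a·a ≠ 1 ∧ g₀ = d(a, (c a)⁻¹) ∧ i = (p_a ⊗ 𝔸, true) ∧
  cl♭ ι(g₀) = i` (★ `exists_rational_eq_hyperbolicDiagonal`, ★ `borelRefine_charpoly_mk_toAdelic_of_eq_hyperbolicDiagonal`).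
* §2 (the CM pin `(L⁺, L, complexConj)`) **`exists_rep_sum_filter_hyperbolic_classPolynomial_eval_zero_cm`** — for any finite
  index set `S`, any family `P` with `∀ i ∈ S, ∃ T₀, ∀ T > T₀, J^T_i(f) = (P i)(log T)` (the socket's first conjunct), and one
  window constant `(C_w, hC, hwin)`: there is a choice of diagonal representatives `γ_i = d(a_i, (c a_i)⁻¹)` of the
  hyperbolic classes `i ∈ S.filter hyperbolic` such that **`P i = C (2·c_μ·C_w·Φ(γ_i, f))·X + C (−c_μ·C_w·J^v(γ_i, f))`** for
  each of them and
  **`Σ_{i ∈ S.filter hyperbolic} (P i).eval 0 = Σ_{i ∈ S.filter hyperbolic} −(c_μ·C_w·J^v(γ_i, f))`** — the (σ-iii)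
  summand of ★ `…ThreeSockets` in closed form (take `S := S♭_f`, `P :=` the socket's polynomials), the WEIGHTED ORBITAL
  INTEGRALS `J^v(γ, f) = ∫_{G(𝔸)⧸T(𝔸)} f(x̃γx̃⁻¹)(log H(x̃⁻¹) + log H(wx̃⁻¹)) d(ν_G∕ρ)` of Rogawski (6.1.3). The representatives
  come as a TOTAL function `rep` on the index type (values off the hyperbolic filter are junk and never read), so consumers
  write `rep i` with no membership certificate; the slope reading `(P i).coeff 1 = 2·c_μ·C_w·Φ(γ_i, f)` rides along inside the
  second conjunct.

Letters: `c_μ = unfoldingConstant G(F) count μ ν_G` (★ LAW 4's), `Φ(γ, f) = ∫ f(x̃γx̃⁻¹) d(quotientMeasure T(𝔸) ρ ν_G)`, `J^v` as above,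
all INLINE exactly as in ★ STEP 5; instance header = ★ STEP 5's verbatim.

## References

* J. D. Rogawski, *Automorphic Representations of Unitary Groups in Three Variables*, Ann. of Math. Stud. 123 (1990), §2.3
  (p. 14), §3.6 (pp. 28–29), §6.1 (pp. 79–80) [Rogawski1990].
* J. Arthur, *A trace formula for reductive groups I*, Duke Math. J. 45 (1978), §8 [Arthur1978TraceFormulaI].
* J. Arthur, *The trace formula in invariant form*, Ann. of Math. 114 (1981), Prop. 2.3 [Arthur1981TraceFormulaInvariantForm].
-/

set_option autoImplicit false

noncomputable section

open MeasureTheory Measure NumberField IsDedekindDomain Set Matrix Polynomial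
open Literature.MeasureTheory.Group
open scoped NNReal ENNReal Classical MatrixGroups

namespace Literature.NumberTheory.Automorphic

namespace UnitaryGroup

/-! ## §1 Diagonal representatives of the hyperbolic socket's classes -/

section Representatives

variable {F E : Type} [Field F] [NumberField F] [Field E] [NumberField E] [Algebra F E]
  {c : E ≃ₐ[F] E}

/-- **EVERY CLASS OF THE HYPERBOLIC SOCKET HAS A DIAGONAL REPRESENTATIVE.** If the refined index `i = (p, flag)` lies in the
hyperbolic filter of ★ `arthurTrace_eq_sum_orbital_add_sum_central_add_sum_singular_add_sum_hyperbolic_cm`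
(`flag = true`, `p = ((X − a)(X − (c a)⁻¹)) ⊗ 𝔸_E` with `c a · a ≠ 1`), then there are such an `a` and a
rational `g₀ = d(a, (c a)⁻¹) ∈ U(J₂)(F)` (★ `exists_rational_eq_hyperbolicDiagonal_two`) with `i = (p, true)` and whose refined
class IS `i` (★ `borelRefine_charpoly_mk_toAdelic_of_eq_hyperbolicDiagonal_two`). [cite: Rogawski1990, §3.6 (pp. 28–29); §6.1 (p. 79)] -/
theorem exists_hyperbolicDiagonal_of_mem_filter_hyperbolic_two (hc : c * c = 1)
    (S : Finset ((AdeleRing (𝓞 E) E)[X] × Bool)) {i : (AdeleRing (𝓞 E) E)[X] × Bool}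
    (hi : i ∈ S.filter (fun i : (AdeleRing (𝓞 E) E)[X] × Bool => i.2 = true ∧ ∃ a : Eˣ, c (a : E) * (a : E) ≠ 1 ∧
        i.1 = ((X - C (a : E)) * (X - C (c (a : E))⁻¹)).map (algebraMap E (AdeleRing (𝓞 E) E)))) :
    ∃ (a : Eˣ) (g₀ : (quasiSplit F E c 2).Rational),
      c (a : E) * (a : E) ≠ 1 ∧
      ((g₀.1 : GL (Fin 2) E) : Matrix (Fin 2) (Fin 2) E) = !![(a : E), 0; 0, (c (a : E))⁻¹] ∧
      i = ((((X - C (a : E)) * (X - C (c (a : E))⁻¹)).map (algebraMap E (AdeleRing (𝓞 E) E))), true) ∧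
      (fun γ : (quasiSplit F E c 2).arithmeticSubgroup =>
          (((adelicVal F E c 2 _ (γ : (quasiSplit F E c 2).Adelic) : GL (Fin 2) (AdeleRing (𝓞 E) E)) :
              Matrix (Fin 2) (Fin 2) (AdeleRing (𝓞 E) E)).charpoly,
            decide (∃ δ : (quasiSplit F E c 2).arithmeticSubgroup, δ * γ * δ⁻¹ ∈ arithmeticBorel F E c 2)))
        ⟨(quasiSplit F E c 2).toAdelic g₀, g₀, rfl⟩ = i := by
  obtain ⟨-, hi2, a, ha, hi1⟩ := Finset.mem_filter.1 hi
  obtain ⟨g₀, hg₀⟩ := exists_rational_eq_hyperbolicDiagonal_two (F := F) hc a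
  have hi' : i = ((((X - C (a : E)) * (X - C (c (a : E))⁻¹)).map (algebraMap E (AdeleRing (𝓞 E) E))), true) :=
    Prod.ext hi1 hi2
  exact ⟨a, g₀, ha, hg₀, hi', hi' ▸ borelRefine_charpoly_mk_toAdelic_of_eq_hyperbolicDiagonal_two ha hg₀⟩

end Representatives

/-! ## §2 The hyperbolic socket, closed (CM pin) -/

section Socket

/-- **THE REGULAR HYPERBOLIC SOCKET, CLOSED** (quasi-split `U(J₂)` of a CM extension `L/L⁺`). Let `S` be a finite set of
refined indices and `P` a family of polynomials with `J^T_i(f) = (P i)(log T)` for `T ≫ 0` at every `i ∈ S` (the first conjunct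
of ★ `arthurTrace_eq_sum_orbital_add_sum_central_add_sum_singular_add_sum_hyperbolic_cm` for `S = S♭_f`), and let `C_w ≠ ∞`
satisfy the rank-one window law of the torus measure `ρ` (★ `exists_rankOneInterval_forall_weight`; ONE constant serves every
class). Then there is a choice of diagonal representatives `γ_i = d(a_i, (c a_i)⁻¹) ∈ U(J₂)(L⁺)` of the hyperbolic classes
`i ∈ S.filter hyperbolic` (so `i = (p_{a_i} ⊗ 𝔸, true)`) such that, for each of them,
`P i = C (2·c_μ·C_w·Φ(γ_i, f))·X + C (−c_μ·C_w·J^v(γ_i, f))` (★ STEP 5 `truncatedTraceClass_borelRefine_hyperbolic_eq_linear_cm_of_window_two`,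
Rogawski (6.1.3)), and consequently
`Σ_{i ∈ S.filter hyperbolic} (P i).eval 0 = Σ_{i ∈ S.filter hyperbolic} −(c_μ·C_w·J^v(γ_i, f))` (`rep` is a TOTAL function on the
index type; its values off the filter are never read):
THE (σ-iii) SUMMAND OF `J(f)` IS `−c_μ·C_w` TIMES THE SUM OF THE WEIGHTED ORBITAL INTEGRALS over the hyperbolic classes of the
live set [Rogawski §2.3: `J(f) = Σ_𝔬 J_𝔬(f)`; §6.1 (6.1.3)]. [cite: Rogawski1990, §2.3 (p. 14); §6.1 (6.1.1)–(6.1.3)]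
[cite: Arthur1978TraceFormulaI, §8] [cite: Arthur1981TraceFormulaInvariantForm, Prop. 2.3] -/
theorem exists_rep_sum_filter_hyperbolic_classPolynomial_eval_zero_cm_two (L : Type) [Field L] [NumberField L] [IsCMField L]
    [MeasurableSpace (adelicUnipotent (↥(maximalRealSubfield L)) L (IsCMField.complexConj L) 2)]
    [BorelSpace (adelicUnipotent (↥(maximalRealSubfield L)) L (IsCMField.complexConj L) 2)]
    [MeasurableSpace (quasiSplit (↥(maximalRealSubfield L)) L (IsCMField.complexConj L) 2).Adelic]
    [BorelSpace (quasiSplit (↥(maximalRealSubfield L)) L (IsCMField.complexConj L) 2).Adelic]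
    [MeasurableSpace ((quasiSplit (↥(maximalRealSubfield L)) L (IsCMField.complexConj L) 2).Adelic ⧸
      torusAdelic (↥(maximalRealSubfield L)) L (IsCMField.complexConj L) 2)]
    [BorelSpace ((quasiSplit (↥(maximalRealSubfield L)) L (IsCMField.complexConj L) 2).Adelic ⧸
      torusAdelic (↥(maximalRealSubfield L)) L (IsCMField.complexConj L) 2)]
    (μ : Measure (quasiSplit (↥(maximalRealSubfield L)) L (IsCMField.complexConj L) 2).automorphicQuotient)
    [(quasiSplit (↥(maximalRealSubfield L)) L (IsCMField.complexConj L) 2).IsAutomorphicMeasure μ]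
    (νG : Measure (quasiSplit (↥(maximalRealSubfield L)) L (IsCMField.complexConj L) 2).Adelic) [νG.IsHaarMeasure]
    (ρ : Measure ↥(torusAdelic (↥(maximalRealSubfield L)) L (IsCMField.complexConj L) 2)) [ρ.IsHaarMeasure] [ρ.IsInvInvariant]
    (ν : Measure (adelicUnipotent (↥(maximalRealSubfield L)) L (IsCMField.complexConj L) 2)) [ν.IsHaarMeasure]
    (𝓕 : Set (adelicUnipotent (↥(maximalRealSubfield L)) L (IsCMField.complexConj L) 2))
    (h𝓕 : IsFundamentalDomain (rationalUnipotent (↥(maximalRealSubfield L)) L (IsCMField.complexConj L) 2) 𝓕 ν)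
    {w : (quasiSplit (↥(maximalRealSubfield L)) L (IsCMField.complexConj L) 2).Rational}
    (hw : ((w.1 : GL (Fin 2) L) : Matrix (Fin 2) (Fin 2) L) = !![(0 : L), 1; 1, 0])
    {f : (quasiSplit (↥(maximalRealSubfield L)) L (IsCMField.complexConj L) 2).Adelic → ℂ}
    (hf : IsQuasiSplitTest (↥(maximalRealSubfield L)) L (IsCMField.complexConj L) 2 f)
    {Cw : ℝ≥0∞} (hC : Cw ≠ ⊤)
    (hwin : ∀ β' : torusInBorel (↥(maximalRealSubfield L)) L (IsCMField.complexConj L) 2 → ℝ≥0∞,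
        IsCoveringWeight ((rationalBorel (↥(maximalRealSubfield L)) L (IsCMField.complexConj L) 2).subgroupOf
          (torusInBorel (↥(maximalRealSubfield L)) L (IsCMField.complexConj L) 2)) β' →
        ∀ A B : ℝ≥0, 0 < A → A ≤ B →
          ∫⁻ s : torusInBorel (↥(maximalRealSubfield L)) L (IsCMField.complexConj L) 2, β' s *
            {s : torusInBorel (↥(maximalRealSubfield L)) L (IsCMField.complexConj L) 2 |
              A < borelHeight (((s : torusInBorel (↥(maximalRealSubfield L)) L (IsCMField.complexConj L) 2) :
                borelAdelic (↥(maximalRealSubfield L)) L (IsCMField.complexConj L) 2) :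
                (quasiSplit (↥(maximalRealSubfield L)) L (IsCMField.complexConj L) 2).Adelic) ∧
              borelHeight (((s : torusInBorel (↥(maximalRealSubfield L)) L (IsCMField.complexConj L) 2) :
                borelAdelic (↥(maximalRealSubfield L)) L (IsCMField.complexConj L) 2) :
                (quasiSplit (↥(maximalRealSubfield L)) L (IsCMField.complexConj L) 2).Adelic) ≤ B}.indicator 1 s
            ∂(Measure.map (⇑(Subgroup.subgroupOfEquivOfLe
              (torusAdelic_le_borelAdelic (F := ↥(maximalRealSubfield L)) (E := L) (c := IsCMField.complexConj L) (N := 2))).symm) ρ :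
                Measure (torusInBorel (↥(maximalRealSubfield L)) L (IsCMField.complexConj L) 2)) =
            Cw * ENNReal.ofReal (Real.log (B : ℝ) - Real.log (A : ℝ)))
    (S : Finset ((AdeleRing (𝓞 L) L)[X] × Bool)) (P : (AdeleRing (𝓞 L) L)[X] × Bool → ℂ[X])
    (hP : ∀ i ∈ S, ∃ T₀ : ℝ≥0, ∀ T : ℝ≥0, T₀ < T →
      truncatedTraceClass μ ν 𝓕 T
          (fun γ : (quasiSplit (↥(maximalRealSubfield L)) L (IsCMField.complexConj L) 2).arithmeticSubgroup =>
            (((adelicVal (↥(maximalRealSubfield L)) L (IsCMField.complexConj L) 2 _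
                (γ : (quasiSplit (↥(maximalRealSubfield L)) L (IsCMField.complexConj L) 2).Adelic) :
                GL (Fin 2) (AdeleRing (𝓞 L) L)) : Matrix (Fin 2) (Fin 2) (AdeleRing (𝓞 L) L)).charpoly,
              decide (∃ δ : (quasiSplit (↥(maximalRealSubfield L)) L (IsCMField.complexConj L) 2).arithmeticSubgroup,
                δ * γ * δ⁻¹ ∈ arithmeticBorel (↥(maximalRealSubfield L)) L (IsCMField.complexConj L) 2)))
          i f = (P i).eval ((Real.log (T : ℝ) : ℝ) : ℂ)) :
    haveI := t2Space_quasiSplitAdelic (F := ↥(maximalRealSubfield L)) (E := L) (c := IsCMField.complexConj L) (N := 2)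
    haveI := locallyCompactSpace_quasiSplitAdelic (F := ↥(maximalRealSubfield L)) (E := L) (c := IsCMField.complexConj L) (N := 2)
    haveI := secondCountableTopology_quasiSplitAdelic (F := ↥(maximalRealSubfield L)) (E := L) (c := IsCMField.complexConj L) (N := 2)
    haveI : DiscreteTopology (quasiSplit (↥(maximalRealSubfield L)) L (IsCMField.complexConj L) 2).quotientSubgroup := by
      rw [quotientSubgroup_quasiSplit]; exact isDiscreteRational_quasiSplit
    haveI : νG.IsMulRightInvariant := isMulRightInvariant_quasiSplit_cm_two L νG
    letI := AdelicGroupData.measurableSpaceQuotientForm (quasiSplit (↥(maximalRealSubfield L)) L (IsCMField.complexConj L) 2)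
    haveI := AdelicGroupData.borelSpaceQuotientForm (quasiSplit (↥(maximalRealSubfield L)) L (IsCMField.complexConj L) 2)
    haveI := AdelicGroupData.smulInvariantMeasureQuotientForm (quasiSplit (↥(maximalRealSubfield L)) L (IsCMField.complexConj L) 2) μ
    haveI := AdelicGroupData.isFiniteMeasureOnCompactsQuotientForm (quasiSplit (↥(maximalRealSubfield L)) L (IsCMField.complexConj L) 2) μ
    ∃ rep : (AdeleRing (𝓞 L) L)[X] × Bool → (quasiSplit (↥(maximalRealSubfield L)) L (IsCMField.complexConj L) 2).Rational,
      (∀ (i : (AdeleRing (𝓞 L) L)[X] × Bool) (hi : i ∈ S.filter (fun i : (AdeleRing (𝓞 L) L)[X] × Bool => i.2 = true ∧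
          ∃ a : Lˣ, (IsCMField.complexConj L) (a : L) * (a : L) ≠ 1 ∧
            i.1 = ((X - C (a : L)) * (X - C ((IsCMField.complexConj L) (a : L))⁻¹)).map
              (algebraMap L (AdeleRing (𝓞 L) L)))),
        ∃ a : Lˣ, (IsCMField.complexConj L) (a : L) * (a : L) ≠ 1 ∧
        (((rep i).1 : GL (Fin 2) L) : Matrix (Fin 2) (Fin 2) L) =
          !![(a : L), 0; 0, ((IsCMField.complexConj L) (a : L))⁻¹] ∧
        i = ((((X - C (a : L)) * (X - C ((IsCMField.complexConj L) (a : L))⁻¹)).map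
            (algebraMap L (AdeleRing (𝓞 L) L))), true)) ∧
      (∀ (i : (AdeleRing (𝓞 L) L)[X] × Bool) (hi : i ∈ S.filter (fun i : (AdeleRing (𝓞 L) L)[X] × Bool => i.2 = true ∧
          ∃ a : Lˣ, (IsCMField.complexConj L) (a : L) * (a : L) ≠ 1 ∧
            i.1 = ((X - C (a : L)) * (X - C ((IsCMField.complexConj L) (a : L))⁻¹)).map
              (algebraMap L (AdeleRing (𝓞 L) L)))),
        P i =
        C (2 * ((unfoldingConstant (quasiSplit (↥(maximalRealSubfield L)) L (IsCMField.complexConj L) 2).quotientSubgroup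
              (count : Measure (quasiSplit (↥(maximalRealSubfield L)) L (IsCMField.complexConj L) 2).quotientSubgroup) μ νG : ℝ) : ℂ) *
            (Cw.toReal : ℂ) *
            ∫ x : (quasiSplit (↥(maximalRealSubfield L)) L (IsCMField.complexConj L) 2).Adelic ⧸
                torusAdelic (↥(maximalRealSubfield L)) L (IsCMField.complexConj L) 2,
              f ((x.out : (quasiSplit (↥(maximalRealSubfield L)) L (IsCMField.complexConj L) 2).Adelic) *
                (quasiSplit (↥(maximalRealSubfield L)) L (IsCMField.complexConj L) 2).toAdelic (rep i) *
                (x.out : (quasiSplit (↥(maximalRealSubfield L)) L (IsCMField.complexConj L) 2).Adelic)⁻¹)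
              ∂(quotientMeasure (torusAdelic (↥(maximalRealSubfield L)) L (IsCMField.complexConj L) 2) ρ isClosed_torusAdelic νG)) * X +
          C (-(((unfoldingConstant (quasiSplit (↥(maximalRealSubfield L)) L (IsCMField.complexConj L) 2).quotientSubgroup
              (count : Measure (quasiSplit (↥(maximalRealSubfield L)) L (IsCMField.complexConj L) 2).quotientSubgroup) μ νG : ℝ) : ℂ) *
            (Cw.toReal : ℂ) *
            ∫ x : (quasiSplit (↥(maximalRealSubfield L)) L (IsCMField.complexConj L) 2).Adelic ⧸
                torusAdelic (↥(maximalRealSubfield L)) L (IsCMField.complexConj L) 2,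
              f ((x.out : (quasiSplit (↥(maximalRealSubfield L)) L (IsCMField.complexConj L) 2).Adelic) *
                  (quasiSplit (↥(maximalRealSubfield L)) L (IsCMField.complexConj L) 2).toAdelic (rep i) *
                  (x.out : (quasiSplit (↥(maximalRealSubfield L)) L (IsCMField.complexConj L) 2).Adelic)⁻¹) *
                ((Real.log (borelHeight (x.out : (quasiSplit (↥(maximalRealSubfield L)) L (IsCMField.complexConj L) 2).Adelic)⁻¹) +
                  Real.log (borelHeight ((quasiSplit (↥(maximalRealSubfield L)) L (IsCMField.complexConj L) 2).toAdelic w *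
                    (x.out : (quasiSplit (↥(maximalRealSubfield L)) L (IsCMField.complexConj L) 2).Adelic)⁻¹)) : ℝ) : ℂ)
              ∂(quotientMeasure (torusAdelic (↥(maximalRealSubfield L)) L (IsCMField.complexConj L) 2) ρ isClosed_torusAdelic νG)))) ∧
      ∑ i ∈ S.filter (fun i : (AdeleRing (𝓞 L) L)[X] × Bool => i.2 = true ∧
          ∃ a : Lˣ, (IsCMField.complexConj L) (a : L) * (a : L) ≠ 1 ∧
            i.1 = ((X - C (a : L)) * (X - C ((IsCMField.complexConj L) (a : L))⁻¹)).map
              (algebraMap L (AdeleRing (𝓞 L) L))),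
          (P i).eval 0 =
        ∑ i ∈ S.filter (fun i : (AdeleRing (𝓞 L) L)[X] × Bool => i.2 = true ∧
          ∃ a : Lˣ, (IsCMField.complexConj L) (a : L) * (a : L) ≠ 1 ∧
            i.1 = ((X - C (a : L)) * (X - C ((IsCMField.complexConj L) (a : L))⁻¹)).map
              (algebraMap L (AdeleRing (𝓞 L) L))),
          -(((unfoldingConstant (quasiSplit (↥(maximalRealSubfield L)) L (IsCMField.complexConj L) 2).quotientSubgroup
              (count : Measure (quasiSplit (↥(maximalRealSubfield L)) L (IsCMField.complexConj L) 2).quotientSubgroup) μ νG : ℝ) : ℂ) *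
            (Cw.toReal : ℂ) *
            ∫ x : (quasiSplit (↥(maximalRealSubfield L)) L (IsCMField.complexConj L) 2).Adelic ⧸
                torusAdelic (↥(maximalRealSubfield L)) L (IsCMField.complexConj L) 2,
              f ((x.out : (quasiSplit (↥(maximalRealSubfield L)) L (IsCMField.complexConj L) 2).Adelic) *
                  (quasiSplit (↥(maximalRealSubfield L)) L (IsCMField.complexConj L) 2).toAdelic (rep i) *
                  (x.out : (quasiSplit (↥(maximalRealSubfield L)) L (IsCMField.complexConj L) 2).Adelic)⁻¹) *
                ((Real.log (borelHeight (x.out : (quasiSplit (↥(maximalRealSubfield L)) L (IsCMField.complexConj L) 2).Adelic)⁻¹) +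
                  Real.log (borelHeight ((quasiSplit (↥(maximalRealSubfield L)) L (IsCMField.complexConj L) 2).toAdelic w *
                    (x.out : (quasiSplit (↥(maximalRealSubfield L)) L (IsCMField.complexConj L) 2).Adelic)⁻¹)) : ℝ) : ℂ)
              ∂(quotientMeasure (torusAdelic (↥(maximalRealSubfield L)) L (IsCMField.complexConj L) 2) ρ isClosed_torusAdelic νG)) := by
  haveI := t2Space_quasiSplitAdelic (F := ↥(maximalRealSubfield L)) (E := L) (c := IsCMField.complexConj L) (N := 2)
  haveI := locallyCompactSpace_quasiSplitAdelic (F := ↥(maximalRealSubfield L)) (E := L) (c := IsCMField.complexConj L) (N := 2)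
  haveI := secondCountableTopology_quasiSplitAdelic (F := ↥(maximalRealSubfield L)) (E := L) (c := IsCMField.complexConj L) (N := 2)
  haveI : νG.IsMulRightInvariant := isMulRightInvariant_quasiSplit_cm_two L νG
  haveI : DiscreteTopology (quasiSplit (↥(maximalRealSubfield L)) L (IsCMField.complexConj L) 2).quotientSubgroup := by
    rw [quotientSubgroup_quasiSplit]; exact isDiscreteRational_quasiSplit
  letI := AdelicGroupData.measurableSpaceQuotientForm (quasiSplit (↥(maximalRealSubfield L)) L (IsCMField.complexConj L) 2)
  haveI := AdelicGroupData.borelSpaceQuotientForm (quasiSplit (↥(maximalRealSubfield L)) L (IsCMField.complexConj L) 2)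
  haveI := AdelicGroupData.smulInvariantMeasureQuotientForm (quasiSplit (↥(maximalRealSubfield L)) L (IsCMField.complexConj L) 2) μ
  haveI := AdelicGroupData.isFiniteMeasureOnCompactsQuotientForm (quasiSplit (↥(maximalRealSubfield L)) L (IsCMField.complexConj L) 2) μ
  have hcc : (IsCMField.complexConj L) * (IsCMField.complexConj L) = 1 := complexConj_mul_complexConj L
  -- §1 at every index of the hyperbolic filter: representatives (a TOTAL choice function, junk off the filter)
  have key : ∀ i : (AdeleRing (𝓞 L) L)[X] × Bool,
      ∃ (a : Lˣ) (g₀ : (quasiSplit (↥(maximalRealSubfield L)) L (IsCMField.complexConj L) 2).Rational),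
        i ∈ S.filter (fun i : (AdeleRing (𝓞 L) L)[X] × Bool => i.2 = true ∧
          ∃ a : Lˣ, (IsCMField.complexConj L) (a : L) * (a : L) ≠ 1 ∧
            i.1 = ((X - C (a : L)) * (X - C ((IsCMField.complexConj L) (a : L))⁻¹)).map
              (algebraMap L (AdeleRing (𝓞 L) L))) →
        (IsCMField.complexConj L) (a : L) * (a : L) ≠ 1 ∧
        ((g₀.1 : GL (Fin 2) L) : Matrix (Fin 2) (Fin 2) L) = !![(a : L), 0; 0, ((IsCMField.complexConj L) (a : L))⁻¹] ∧
        i = ((((X - C (a : L)) * (X - C ((IsCMField.complexConj L) (a : L))⁻¹)).map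
            (algebraMap L (AdeleRing (𝓞 L) L))), true) := by
    intro i
    by_cases hi : i ∈ S.filter (fun i : (AdeleRing (𝓞 L) L)[X] × Bool => i.2 = true ∧
          ∃ a : Lˣ, (IsCMField.complexConj L) (a : L) * (a : L) ≠ 1 ∧
            i.1 = ((X - C (a : L)) * (X - C ((IsCMField.complexConj L) (a : L))⁻¹)).map
              (algebraMap L (AdeleRing (𝓞 L) L)))
    · obtain ⟨a, g₀, ha, hg₀, hi', -⟩ :=
        exists_hyperbolicDiagonal_of_mem_filter_hyperbolic_two (F := ↥(maximalRealSubfield L)) hcc S hi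
      exact ⟨a, g₀, fun _ => ⟨ha, hg₀, hi'⟩⟩
    · exact ⟨1, 1, fun h => absurd h hi⟩
  choose a rep hspec using key
  -- the class polynomial at each hyperbolic index, from ★ STEP 5 with ONE window constant
  have hpoly : ∀ (i : (AdeleRing (𝓞 L) L)[X] × Bool) (hi : i ∈ S.filter (fun i : (AdeleRing (𝓞 L) L)[X] × Bool => i.2 = true ∧
          ∃ a : Lˣ, (IsCMField.complexConj L) (a : L) * (a : L) ≠ 1 ∧
            i.1 = ((X - C (a : L)) * (X - C ((IsCMField.complexConj L) (a : L))⁻¹)).map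
              (algebraMap L (AdeleRing (𝓞 L) L)))),
      P i =
      C (2 * ((unfoldingConstant (quasiSplit (↥(maximalRealSubfield L)) L (IsCMField.complexConj L) 2).quotientSubgroup
            (count : Measure (quasiSplit (↥(maximalRealSubfield L)) L (IsCMField.complexConj L) 2).quotientSubgroup) μ νG : ℝ) : ℂ) *
          (Cw.toReal : ℂ) *
          ∫ x : (quasiSplit (↥(maximalRealSubfield L)) L (IsCMField.complexConj L) 2).Adelic ⧸
              torusAdelic (↥(maximalRealSubfield L)) L (IsCMField.complexConj L) 2,
            f ((x.out : (quasiSplit (↥(maximalRealSubfield L)) L (IsCMField.complexConj L) 2).Adelic) *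
              (quasiSplit (↥(maximalRealSubfield L)) L (IsCMField.complexConj L) 2).toAdelic (rep i) *
              (x.out : (quasiSplit (↥(maximalRealSubfield L)) L (IsCMField.complexConj L) 2).Adelic)⁻¹)
            ∂(quotientMeasure (torusAdelic (↥(maximalRealSubfield L)) L (IsCMField.complexConj L) 2) ρ isClosed_torusAdelic νG)) * X +
        C (-(((unfoldingConstant (quasiSplit (↥(maximalRealSubfield L)) L (IsCMField.complexConj L) 2).quotientSubgroup
            (count : Measure (quasiSplit (↥(maximalRealSubfield L)) L (IsCMField.complexConj L) 2).quotientSubgroup) μ νG : ℝ) : ℂ) *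
          (Cw.toReal : ℂ) *
          ∫ x : (quasiSplit (↥(maximalRealSubfield L)) L (IsCMField.complexConj L) 2).Adelic ⧸
              torusAdelic (↥(maximalRealSubfield L)) L (IsCMField.complexConj L) 2,
            f ((x.out : (quasiSplit (↥(maximalRealSubfield L)) L (IsCMField.complexConj L) 2).Adelic) *
                (quasiSplit (↥(maximalRealSubfield L)) L (IsCMField.complexConj L) 2).toAdelic (rep i) *
                (x.out : (quasiSplit (↥(maximalRealSubfield L)) L (IsCMField.complexConj L) 2).Adelic)⁻¹) *
              ((Real.log (borelHeight (x.out : (quasiSplit (↥(maximalRealSubfield L)) L (IsCMField.complexConj L) 2).Adelic)⁻¹) +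
                Real.log (borelHeight ((quasiSplit (↥(maximalRealSubfield L)) L (IsCMField.complexConj L) 2).toAdelic w *
                  (x.out : (quasiSplit (↥(maximalRealSubfield L)) L (IsCMField.complexConj L) 2).Adelic)⁻¹)) : ℝ) : ℂ)
            ∂(quotientMeasure (torusAdelic (↥(maximalRealSubfield L)) L (IsCMField.complexConj L) 2) ρ isClosed_torusAdelic νG))) := by
    intro i hi
    obtain ⟨ha, hg₀, hidx⟩ := hspec i hi
    obtain ⟨T₀, hT₀⟩ := hP i (Finset.mem_of_mem_filter i hi)
    have hrow := (truncatedTraceClass_borelRefine_hyperbolic_eq_linear_cm_of_window_two L μ νG ρ ν 𝓕 h𝓕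
      ha hg₀ hw hf hC hwin).2 (P i) T₀
    refine hrow fun T hT => ?_
    rw [← hidx]
    exact hT₀ T hT
  refine ⟨rep, fun i hi => ⟨a i, hspec i hi⟩, hpoly, ?_⟩
  -- sum the constant terms
  refine Finset.sum_congr rfl fun i hi => ?_
  rw [hpoly i hi, eval_add, eval_mul, eval_C, eval_X, eval_C, mul_zero, zero_add]

end Socket

end UnitaryGroup

end Literature.NumberTheory.Automorphic
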